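import Summits.BirchSwinnertonDyer.Rank1Residual.P2.Conjectures.CongruentNumberSilentEvenFiveAtTwo
import HarnessLib

/-!
# Cell «bsd-monsky» (typer): the Lean HOOK of PROOF-A's Theorem A (b) — `L′(E_N, 1) = (4m²/𝓛(1)²)·Ω·Reg`
# with `m`, `𝓛(1)` odd ⟹ C-P2-1 (both forms) — nothing asserted

HONEST FRAMING (cell `bsd-monsky`, run/shared/lean/pub/bsd-monsky/; README §1): this file asserts NO arithmetic
fact. PROOF-A (`HOME/proof/PROOF-A.md`, prover-A, 2026-08-25; awaiting the cross-family referee) ends at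
(9.4.1) `L′(E_N, 1) = (4m²/𝓛(1)²) · Ω_N · Reg(E_N)` with `m` = the index of Tian's Heegner point `y` in
`E_N(ℚ)/tor` (ODD by §7) and `𝓛(1)` an ODD integer (TYZ Thm. 1.1 at `n = 1`), on every `N = 2pq ∈ 𝒮⁻`, and
names the tree's `CongruentSilentEvenFiveOrdTwo` as its target. This file is the one-line bridge from that
displayed shape to the two `@[conjecture]` `Prop`s of C-P2-1: `x := 4m²/𝓛(1)²` is a non-zero rational with
`ord₂ x = 2`. The hypothesis `hA` is exactly Theorem A (b) of PROOF-A with its constants displayed; PROOF-A's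
(a) (`ord_{s=1} L = 1`) is recovered inside the tree (root number `−1` and `L′ ≠ 0`, door D-CN-5). Periods and
heights are the tree's (`realPeriodRat`, `regulator`), which PROOF-A §9.2 identifies with `Ω_{N,∞}` and
`2ĥ_{TYZ}(β)` (tree: `realPeriodRat_congruentNumberCurve`).

The odd-index datum of `P2/CongruentNumberSilentEvenFiveOddIndexDatum.lean` is the same content one step
earlier (`m = ±𝓛(1)𝓛(N)`); both hooks lead to the same conjecture `Prop`s. Nothing booked; no mark moved.

References: HOME/proof/PROOF-A.md §0 (Theorem A), §7 (odd index), §9 ((9.1.4), (9.4.1)); [TianYuanZhang2017] Thm. 1.1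
(`n = 1`), Thm. 3.3; [Monsky1990MockHeegner] Cor. 5.15 (2′) (p. 66), Thm. 5.14 (13)/(15) (p. 66); [Miller2011LMS] Def. 1.1.
-/

noncomputable section

open scoped Classical

open WeierstrassCurve Literature.NumberTheory.EllipticCurves
  Literature.NumberTheory.EllipticCurves.Monsky1990

set_option autoImplicit false

namespace Summit.BirchSwinnertonDyer.Rank1Residual.P2

open Conjectures

/-- `ord₂ (4m²/u²) = 2` for odd integers `m`, `u` (the `2`-adic bookkeeping of PROOF-A (9.4.1)). [folklore] -/
theorem padicValRat_two_four_mul_sq_div_sq {m u : ℤ} (hm : Odd m) (hu : Odd u) :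
    padicValRat 2 ((4 : ℚ) * (m : ℚ) ^ 2 / (u : ℚ) ^ 2) = 2 := by
  haveI : Fact (Nat.Prime 2) := ⟨Nat.prime_two⟩
  have hm0' : m ≠ 0 := fun h => by simp [h] at hm
  have hu0' : u ≠ 0 := fun h => by simp [h] at hu
  have hm0 : (m : ℚ) ≠ 0 := by exact_mod_cast hm0'
  have hu0 : (u : ℚ) ≠ 0 := by exact_mod_cast hu0'
  have hu2 : ¬ (2 : ℤ) ∣ u := by
    rw [← even_iff_two_dvd]; exact Int.not_even_iff_odd.mpr hu
  have hvu : padicValRat 2 ((u : ℚ) ^ 2) = 0 := by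
    rw [padicValRat.pow (u : ℚ) (k := 2), padicValRat.of_int, padicValInt.eq_zero_of_not_dvd hu2]
    simp
  have h4 : (4 : ℚ) * (m : ℚ) ^ 2 = (2 : ℚ) ^ (2 : ℤ) * (m : ℚ) ^ 2 := by norm_num
  rw [padicValRat.div (mul_ne_zero four_ne_zero (pow_ne_zero 2 hm0)) (pow_ne_zero 2 hu0), hvu, sub_zero, h4,
    padicValRat_two_zpow_mul_sq hm]

/-- **PROOF-A, Theorem A (b) ⟹ C-P2-1, sharper form.** If for every `(p, q) ∈ 𝒮⁻` there are ODD integers `m`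
(the index of Tian's Heegner point) and `u` (`= 𝓛(1)`) with `L′(E_{2pq}, 1) = (4m²/u²) · Ω(E_{2pq}) · Reg(E_{2pq})`
(PROOF-A (9.4.1)), then `CongruentSilentEvenFiveOrdTwo` (`x = 4m²/u²`, `x ≠ 0`, `ord₂ x = 2`). Pure bookkeeping;
the conclusion is CONDITIONAL on `hA`. [cite: Miller2011LMS, Def. 1.1 (arXiv:1010.2431 p. 3)]
[cite: TianYuanZhang2017, Thm. 1.1 (n = 1), Thm. 3.3] -/
theorem congruentSilentEvenFiveOrdTwo_of_proofA
    (hA : ∀ p q : ℕ, p.Prime → q.Prime → p % 8 = 5 → q % 4 = 3 → jacobiSym p q = -1 →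
      ∃ m u : ℤ, Odd m ∧ Odd u ∧
        deriv (congruentNumberCurve (2 * (p * q))).entireLFunction 1 =
          (((4 : ℚ) * (m : ℚ) ^ 2 / (u : ℚ) ^ 2 : ℚ) : ℂ) *
            ((congruentNumberCurve (2 * (p * q))).realPeriodRat : ℂ) *
              ((congruentNumberCurve (2 * (p * q))).regulator : ℂ)) :
    CongruentSilentEvenFiveOrdTwo := by
  intro p q hp hq hp5 hq4 hj
  obtain ⟨m, u, hm, hu, hderiv⟩ := hA p q hp hq hp5 hq4 hj
  have hm0 : (m : ℚ) ≠ 0 := by exact_mod_cast (fun h => by simp [h] at hm : m ≠ 0)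
  have hu0 : (u : ℚ) ≠ 0 := by exact_mod_cast (fun h => by simp [h] at hu : u ≠ 0)
  exact ⟨(4 : ℚ) * (m : ℚ) ^ 2 / (u : ℚ) ^ 2,
    div_ne_zero (mul_ne_zero four_ne_zero (pow_ne_zero 2 hm0)) (pow_ne_zero 2 hu0), hderiv,
    padicValRat_two_four_mul_sq_div_sq hm hu⟩

/-- **PROOF-A, Theorem A (b) ⟹ C-P2-1, observable form** (`ord_{s=1} L(E_{2pq}, s) = 1 ∧ BSD(E_{2pq}, 2)` on all
of `𝒮⁻`), through the landed equivalence of the two forms (Monsky 1990 Cor 5.15 = `h515` for rank one and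
`Ш[2^∞] = 0`, door D-CN-5). CONDITIONAL on `hA` and `h515`; nothing asserted.
[cite: Monsky1990MockHeegner, Cor. 5.15 (2′) (p. 66)] [cite: Miller2011LMS, Def. 1.1 (arXiv:1010.2431 p. 3)] -/
theorem congruentSilentEvenFiveBSDTwo_of_proofA
    (h515 : cor515_rank_eq_one_and_card_selmerGroup_two)
    (hA : ∀ p q : ℕ, p.Prime → q.Prime → p % 8 = 5 → q % 4 = 3 → jacobiSym p q = -1 →
      ∃ m u : ℤ, Odd m ∧ Odd u ∧
        deriv (congruentNumberCurve (2 * (p * q))).entireLFunction 1 =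
          (((4 : ℚ) * (m : ℚ) ^ 2 / (u : ℚ) ^ 2 : ℚ) : ℂ) *
            ((congruentNumberCurve (2 * (p * q))).realPeriodRat : ℂ) *
              ((congruentNumberCurve (2 * (p * q))).regulator : ℂ)) :
    CongruentSilentEvenFiveBSDTwo :=
  congruentSilentEvenFiveBSDTwo_of_ordTwo h515 (congruentSilentEvenFiveOrdTwo_of_proofA hA)

end Summit.BirchSwinnertonDyer.Rank1Residual.P2

end
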